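import Literature.Algebra.Homology.StupidFiltration
import Mathlib.Algebra.Homology.Additive
import HarnessLib

/-!
# The stupid filtration commutes with additive functors

For an additive functor `F : C ⥤ D` between preadditive categories with zero objects and a
`ℤ`-indexed cochain complex `K`, the stupid truncations `σ≤n` of
`Literature/Algebra/Homology/StupidFiltration.lean` commute with `F` degreewise
(`F(σ≤n K)ⁱ = F(Kⁱ)` for `i ≤ n`, `F(0) ≅ 0` above), and so do all the structure maps of the stupid
filtration. Everything is proved:

* `mapStupidTruncLEIso F K n : F(σ≤n K) ≅ σ≤n F(K)` (`mapStupidTruncLEIso_hom_f`: the identity of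
  `F(Kⁱ)` in degrees `i ≤ n`);
* compatibility with the projections `K ⟶ σ≤n K` (`map_stupidTruncLEπ`), the transition maps
  `σ≤b K ⟶ σ≤a K` (`map_stupidTruncLEMapOfLE`), functoriality in `K` (`map_stupidTruncLEMap`) and
  the inclusions of the top terms `Kⁿ[-n] ⟶ σ≤n K` (`map_singleToStupidTruncLE`, through Mathlib's
  `HomologicalComplex.singleMapHomologicalComplex : F(A[-n]) ≅ F(A)[-n]`);
* **`mapStupidFiltrationShortComplexIso`**: the isomorphism of short complexes of complexes
  `F(Kⁿ¹[-n₁] → σ≤n₁ K → σ≤n₀ K) ≅ (F(K)ⁿ¹[-n₁] → σ≤n₁ F(K) → σ≤n₀ F(K))`, i.e. `F` maps the short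
  exact sequences of the stupid filtration of `K` (`stupidFiltrationShortComplex`) to those of
  `F(K)`.

## Why

Combined with the functoriality of hyper-Ext along an exact functor `F` and its compatibility with
connecting homomorphisms (`Literature/Algebra/Homology/HyperExtExactFunctor.lean`) and
`HyperExt.delta_naturality`, this says that the connecting maps
`ℍᵏ(σ≤n₀ K) → Hᵏ⁺¹⁻ⁿ¹(Kⁿ¹)` of the stupid filtration — the differentials of the "filtration bête"
spectral sequence, e.g. Hodge-to-de Rham — commute with exact functors such as restriction to an
open subscheme or flat base change (Deligne, *Théorie de Hodge II*, §1.4).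

## References

* C. A. Weibel, *An introduction to homological algebra*, CUP 1994, 1.2.7–1.2.8 (brutal
  truncations, translation). [Weibel1994]
* P. Deligne, *Théorie de Hodge II*, Publ. Math. IHÉS 40 (1971), §1.4 (filtration bête). [folklore]
-/

noncomputable section

namespace Literature.Algebra.Homology

open CategoryTheory Category Limits ZeroObject

universe v v' u u'

variable {C : Type u} [Category.{v} C] {D : Type u'} [Category.{v'} D]
  [Preadditive C] [HasZeroObject C] [Preadditive D] [HasZeroObject D]
  (F : C ⥤ D) [F.Additive] (K L : CochainComplex C ℤ) (φ : K ⟶ L)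

-- `CochainComplex.singleFunctor C n` is `HomologicalComplex.single _ _ n` only up to unfolding.
set_option backward.isDefEq.respectTransparency false

/-- **`F(σ≤n K) ≅ σ≤n F(K)`**: the stupid truncation commutes with any additive functor (both sides
are `F(Kⁱ)` in degrees `i ≤ n` and zero above). [folklore] -/
def mapStupidTruncLEIso (n : ℤ) :
    (F.mapHomologicalComplex (ComplexShape.up ℤ)).obj (stupidTruncLE K n) ≅
      stupidTruncLE ((F.mapHomologicalComplex (ComplexShape.up ℤ)).obj K) n :=
  HomologicalComplex.Hom.isoOfComponents
    (fun i => if hi : i ≤ n then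
        F.mapIso (stupidTruncLEXIso K n i hi) ≪≫
          (stupidTruncLEXIso ((F.mapHomologicalComplex (ComplexShape.up ℤ)).obj K) n i hi).symm
      else
        (F.map_isZero (isZero_stupidTruncLE_X K n i (not_le.1 hi))).iso
          (isZero_stupidTruncLE_X _ n i (not_le.1 hi)))
    (fun i j hij => by
      by_cases hj : j ≤ n
      · have hi : i ≤ n := by change i + 1 = j at hij; omega
        rw [dif_pos hi, dif_pos hj, Functor.mapHomologicalComplex_obj_d,
          stupidTruncLE_d_eq K n i j hi hj,
          stupidTruncLE_d_eq ((F.mapHomologicalComplex (ComplexShape.up ℤ)).obj K) n i j hi hj]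
        simp [Functor.map_comp]
      · exact (isZero_stupidTruncLE_X _ n j (not_le.1 hj)).eq_of_tgt _ _)

/-- The degree-`i` component of `F(σ≤n K) ≅ σ≤n F(K)` for `i ≤ n`. [folklore] -/
theorem mapStupidTruncLEIso_hom_f (n i : ℤ) (hi : i ≤ n) :
    (mapStupidTruncLEIso F K n).hom.f i = F.map (stupidTruncLEXIso K n i hi).hom ≫
      (stupidTruncLEXIso ((F.mapHomologicalComplex (ComplexShape.up ℤ)).obj K) n i hi).inv := by
  simp [mapStupidTruncLEIso, dif_pos hi]

/-- `F(σ≤n K) ≅ σ≤n F(K)` is compatible with the projections `K ⟶ σ≤n K`. [folklore] -/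
@[reassoc]
theorem map_stupidTruncLEπ (n : ℤ) :
    (F.mapHomologicalComplex (ComplexShape.up ℤ)).map (stupidTruncLEπ K n) ≫
        (mapStupidTruncLEIso F K n).hom =
      stupidTruncLEπ ((F.mapHomologicalComplex (ComplexShape.up ℤ)).obj K) n := by
  ext i
  by_cases hi : i ≤ n
  · rw [HomologicalComplex.comp_f, Functor.mapHomologicalComplex_map_f,
      mapStupidTruncLEIso_hom_f F K n i hi, stupidTruncLEπ_f_eq _ n i hi,
      stupidTruncLEπ_f_eq _ n i hi, ← F.map_comp_assoc, Iso.inv_hom_id, F.map_id, id_comp]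
  · exact (isZero_stupidTruncLE_X _ n i (not_le.1 hi)).eq_of_tgt _ _

/-- `F(σ≤n K) ≅ σ≤n F(K)` is compatible with the transition maps `σ≤b ⟶ σ≤a`. [folklore] -/
@[reassoc]
theorem map_stupidTruncLEMapOfLE (a b : ℤ) (h : a ≤ b) :
    (F.mapHomologicalComplex (ComplexShape.up ℤ)).map (stupidTruncLEMapOfLE K a b h) ≫
        (mapStupidTruncLEIso F K a).hom =
      (mapStupidTruncLEIso F K b).hom ≫
        stupidTruncLEMapOfLE ((F.mapHomologicalComplex (ComplexShape.up ℤ)).obj K) a b h := by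
  ext i
  by_cases hi : i ≤ a
  · rw [HomologicalComplex.comp_f, HomologicalComplex.comp_f, Functor.mapHomologicalComplex_map_f,
      mapStupidTruncLEIso_hom_f F K a i hi, mapStupidTruncLEIso_hom_f F K b i (hi.trans h),
      stupidTruncLEMapOfLE_f_eq _ a b h i hi, stupidTruncLEMapOfLE_f_eq _ a b h i hi,
      ← F.map_comp_assoc, assoc, Iso.inv_hom_id, comp_id, assoc, Iso.inv_hom_id_assoc]
  · exact (isZero_stupidTruncLE_X _ a i (not_le.1 hi)).eq_of_tgt _ _

/-- `F(σ≤n K) ≅ σ≤n F(K)` is natural in `K`. [folklore] -/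
@[reassoc]
theorem map_stupidTruncLEMap (n : ℤ) :
    (F.mapHomologicalComplex (ComplexShape.up ℤ)).map (stupidTruncLEMap φ n) ≫
        (mapStupidTruncLEIso F L n).hom =
      (mapStupidTruncLEIso F K n).hom ≫
        stupidTruncLEMap ((F.mapHomologicalComplex (ComplexShape.up ℤ)).map φ) n := by
  ext i
  by_cases hi : i ≤ n
  · rw [HomologicalComplex.comp_f, HomologicalComplex.comp_f, Functor.mapHomologicalComplex_map_f,
      mapStupidTruncLEIso_hom_f F K n i hi, mapStupidTruncLEIso_hom_f F L n i hi,
      stupidTruncLEMap_f_eq _ n i hi, stupidTruncLEMap_f_eq _ n i hi,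
      Functor.mapHomologicalComplex_map_f]
    simp [Functor.map_comp]
  · exact (isZero_stupidTruncLE_X _ n i (not_le.1 hi)).eq_of_tgt _ _

/-- `F(σ≤n K) ≅ σ≤n F(K)` is compatible with the inclusions of the top terms `Kⁿ[-n] ⟶ σ≤n K`,
through `F(Kⁿ[-n]) ≅ F(Kⁿ)[-n]` (Mathlib `HomologicalComplex.singleMapHomologicalComplex`).
[folklore] -/
@[reassoc]
theorem map_singleToStupidTruncLE (n : ℤ) :
    (F.mapHomologicalComplex (ComplexShape.up ℤ)).map (singleToStupidTruncLE K n) ≫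
        (mapStupidTruncLEIso F K n).hom =
      (HomologicalComplex.singleMapHomologicalComplex F (ComplexShape.up ℤ) n).hom.app (K.X n) ≫
        singleToStupidTruncLE ((F.mapHomologicalComplex (ComplexShape.up ℤ)).obj K) n := by
  ext i
  by_cases hi : i = n
  · subst hi
    rw [HomologicalComplex.comp_f, HomologicalComplex.comp_f, Functor.mapHomologicalComplex_map_f,
      mapStupidTruncLEIso_hom_f F K i i le_rfl, singleToStupidTruncLE_f_self,
      singleToStupidTruncLE_f_self, HomologicalComplex.singleMapHomologicalComplex_hom_app_self,
      F.map_comp, assoc, ← F.map_comp_assoc (stupidTruncLEXIso K i i le_rfl).inv, Iso.inv_hom_id,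
      F.map_id, id_comp, assoc]
    erw [Iso.inv_hom_id_assoc]
  · rcases lt_or_gt_of_ne hi with hlt | hgt
    · exact (F.map_isZero (HomologicalComplex.isZero_single_obj_X (ComplexShape.up ℤ) n (K.X n)
        i hi)).eq_of_src _ _
    · exact (isZero_stupidTruncLE_X _ n i hgt).eq_of_tgt _ _

/-- **The short exact sequences of the stupid filtration commute with additive functors**:
`F(Kⁿ¹[-n₁] → σ≤n₁ K → σ≤n₀ K) ≅ (F(K)ⁿ¹[-n₁] → σ≤n₁ F(K) → σ≤n₀ F(K))` as short complexes of
complexes. [folklore] -/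
def mapStupidFiltrationShortComplexIso (n₀ n₁ : ℤ) (h : n₀ + 1 = n₁) :
    (stupidFiltrationShortComplex K n₀ n₁ h).map (F.mapHomologicalComplex (ComplexShape.up ℤ)) ≅
      stupidFiltrationShortComplex ((F.mapHomologicalComplex (ComplexShape.up ℤ)).obj K) n₀ n₁ h :=
  ShortComplex.isoMk
    ((HomologicalComplex.singleMapHomologicalComplex F (ComplexShape.up ℤ) n₁).app (K.X n₁))
    (mapStupidTruncLEIso F K n₁) (mapStupidTruncLEIso F K n₀)
    (map_singleToStupidTruncLE F K n₁).symm (map_stupidTruncLEMapOfLE F K n₀ n₁ (by omega)).symm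

/-- First component of `mapStupidFiltrationShortComplexIso`: `F(Kⁿ¹[-n₁]) ≅ F(Kⁿ¹)[-n₁]`. [folklore] -/
@[simp]
theorem mapStupidFiltrationShortComplexIso_hom_τ₁ (n₀ n₁ : ℤ) (h : n₀ + 1 = n₁) :
    (mapStupidFiltrationShortComplexIso F K n₀ n₁ h).hom.τ₁ =
      (HomologicalComplex.singleMapHomologicalComplex F (ComplexShape.up ℤ) n₁).hom.app (K.X n₁) :=
  rfl

/-- Second component of `mapStupidFiltrationShortComplexIso`: `F(σ≤n₁ K) ≅ σ≤n₁ F(K)`. [folklore] -/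
@[simp]
theorem mapStupidFiltrationShortComplexIso_hom_τ₂ (n₀ n₁ : ℤ) (h : n₀ + 1 = n₁) :
    (mapStupidFiltrationShortComplexIso F K n₀ n₁ h).hom.τ₂ = (mapStupidTruncLEIso F K n₁).hom :=
  rfl

/-- Third component of `mapStupidFiltrationShortComplexIso`: `F(σ≤n₀ K) ≅ σ≤n₀ F(K)`. [folklore] -/
@[simp]
theorem mapStupidFiltrationShortComplexIso_hom_τ₃ (n₀ n₁ : ℤ) (h : n₀ + 1 = n₁) :
    (mapStupidFiltrationShortComplexIso F K n₀ n₁ h).hom.τ₃ = (mapStupidTruncLEIso F K n₀).hom :=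
  rfl

end Literature.Algebra.Homology
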